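import Mathlib.Data.Fin.Tuple.Sort
import Literature.Computability.AlgebraicComplexity.SupportEntropy
import Literature.Computability.AlgebraicComplexity.EchelonRows
import HarnessLib

/-!
# Strassen's upper support functional in flag form: monotonicity and the product bound

Topic `Literature/Computability/AlgebraicComplexity`. For a 3-tensor `t` over a field and a *frame*
— three matrices `A, B, C` with rows indexed by `Fin N₁, Fin N₂, Fin N₃` and spanning the three
coordinate spaces (ordered spanning families) — consider the down-closure
`cl supp((A ⊗ B ⊗ C)·t) = {x | ∃ y ∈ supp((A ⊗ B ⊗ C)·t), x ≤ y}` of the support in the product of the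
three `Fin` orders, and its maximal `θ`-weighted marginal entropy
`H_θ(cl supp((A ⊗ B ⊗ C)·t))` (`maxWeightedEntropy`, CVZ Def. 2.2). By CVZ Lemma 2.13 this is the
entropy `H_θ(supp_F t)` of the support of `t` with respect to the triple of complete flags `F`
spanned by the tails of the three families, so its minimum over all frames is Strassen's
`ρ^θ(t) = log₂ ζ^θ(t)` in the flag characterisation of CVZ Prop. 2.6 ([Str91]). This file proves,
frame by frame and without using Prop. 2.6, the two upper-bound properties of this quantity that the
barrier of CLLZ 2025 consumes:

* `exists_frame_le_of_restriction` — **monotonicity under restriction** (Strassen; CVZ Thm. 2.4 (4)):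
  for every frame `(A, B, C)` of `f` and every restriction `g = (X ⊗ Y ⊗ Z)·f` there is a frame
  `(A', B', C')` of `g` with `H_θ(cl supp((A' ⊗ B' ⊗ C')·g)) ≤ H_θ(cl supp((A ⊗ B ⊗ C)·f))`.
  Proof: write `X = X̂ A` (rows of `A` span), bring `X̂` into row echelon form by a spanning `U`
  (`exists_echelon_rows`): then every support point of `(UX̂ ⊗ VŶ ⊗ WẐ)·f̂`, `f̂ = (A ⊗ B ⊗ C)·f`,
  lies in a nonzero row and dominates, after applying the strictly increasing pivot maps, a support
  point of `f̂`; transport along the pivot maps (`maxWeightedEntropy_le_of_injOn`).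
* `exists_frame_kroneckerPow_le` — **product upper bound by a dual certificate** (the computation
  behind CVZ Thm. 2.4 (3), (5) and CLLZ 2025, §4.4, eq. (9): `log₂ ζ^θ(T) ≤ max_P ∑ θᵢ H(Pᵢ)`,
  evaluated by convex duality): if positive sub-probability vectors `Q₁, Q₂, Q₃` have cost
  `∑ᵢ θᵢ log₂(1/Qᵢ(xᵢ)) ≤ V` on `supp t`, then `t^{⊗k}` has a frame (sorting the standard bases by
  cost) with `H_θ(cl supp) ≤ k V`.
* `exists_of_actTensor_ne_zero` — a nonzero entry of `(A ⊗ B ⊗ C)·t` has witnesses.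

No definitions are introduced; the functional itself (an infimum over frames) is not needed by the
consumers, which chain the frame-wise statements.

## References

* V. Strassen, *Degeneration and complexity of bilinear maps: some asymptotic spectra*, J. reine
  angew. Math. 413 (1991) — cited through CVZ.
* M. Christandl, P. Vrana, J. Zuiddam, J. Amer. Math. Soc. 36 (2023), Def. 2.2, Thm. 2.4,
  Prop. 2.6, Lemma 2.13. [ChristandlVranaZuiddam2023]
* M. Christandl, F. Le Gall, V. Lysikov, J. Zuiddam, comput. complexity 34 (2025), §4.1–4.4.
  [ChristandlLeGallLysikovZuiddam2025]
-/

noncomputable section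

open scoped BigOperators

namespace Literature.Computability.AlgebraicComplexity

/-! ## Support of an acted tensor -/

section Support

variable {K : Type*} [Field K] {ι κ μ ι' κ' μ' : Type*} [Fintype ι] [Fintype κ] [Fintype μ]

/-- A nonzero entry `((A ⊗ B ⊗ C)·t)_{a'b'c'} ≠ 0` has witnesses `a, b, c` with
`A_{a'a}, B_{b'b}, C_{c'c}, t_{abc}` all nonzero. [folklore] -/
theorem exists_of_actTensor_ne_zero (A : Matrix ι' ι K) (B : Matrix κ' κ K) (C : Matrix μ' μ K)
    (t : ι → κ → μ → K) {a' : ι'} {b' : κ'} {c' : μ'} (h : actTensor A B C t a' b' c' ≠ 0) :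
    ∃ a b c, A a' a ≠ 0 ∧ B b' b ≠ 0 ∧ C c' c ≠ 0 ∧ t a b c ≠ 0 := by
  rw [actTensor_apply] at h
  obtain ⟨a, -, ha⟩ := Finset.exists_ne_zero_of_sum_ne_zero h
  obtain ⟨b, -, hb⟩ := Finset.exists_ne_zero_of_sum_ne_zero ha
  obtain ⟨c, -, hc⟩ := Finset.exists_ne_zero_of_sum_ne_zero hb
  simp only [mul_ne_zero_iff] at hc
  exact ⟨a, b, c, hc.1.1.1, hc.1.1.2, hc.1.2, hc.2⟩

end Support

/-! ## Monotonicity under restriction, frame by frame -/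

section Monotone

variable {K : Type*} [Field K] {ι κ μ ι' κ' μ' : Type*} [Fintype ι] [Fintype κ] [Fintype μ]
  [Fintype ι'] [Fintype κ'] [Fintype μ']

/-- **Monotonicity of the flag support entropy under restriction** (Strassen's Thm., CVZ Thm. 2.4 (4),
in the flag form of Prop. 2.6, frame by frame): for `θ ≥ 0`, every frame `(A, B, C)` of `f` (rows
spanning) and every restriction `(X ⊗ Y ⊗ Z)·f` of `f`, there is a frame `(A', B', C')` of the
restriction whose down-closed support has `θ`-entropy at most that of the frame `(A, B, C)` of `f`.
[cite: ChristandlVranaZuiddam2023, Thm. 2.4 and Prop. 2.6] -/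
theorem exists_frame_le_of_restriction {θ : Fin 3 → ℝ} (hθ : ∀ i, 0 ≤ θ i) (f : ι → κ → μ → K)
    {N₁ N₂ N₃ : ℕ} (A : Matrix (Fin N₁) ι K) (B : Matrix (Fin N₂) κ K) (C : Matrix (Fin N₃) μ K)
    (hA : Submodule.span K (Set.range A.row) = ⊤) (hB : Submodule.span K (Set.range B.row) = ⊤)
    (hC : Submodule.span K (Set.range C.row) = ⊤)
    (X : Matrix ι' ι K) (Y : Matrix κ' κ K) (Z : Matrix μ' μ K) :
    ∃ (M₁ M₂ M₃ : ℕ) (A' : Matrix (Fin M₁) ι' K) (B' : Matrix (Fin M₂) κ' K)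
      (C' : Matrix (Fin M₃) μ' K),
      Submodule.span K (Set.range A'.row) = ⊤ ∧ Submodule.span K (Set.range B'.row) = ⊤ ∧
      Submodule.span K (Set.range C'.row) = ⊤ ∧
      maxWeightedEntropy θ
          {x | ∃ y ∈ tensorSupport (actTensor A' B' C' (actTensor X Y Z f)), x ≤ y} ≤
        maxWeightedEntropy θ {x | ∃ y ∈ tensorSupport (actTensor A B C f), x ≤ y} := by
  classical
  -- express `X, Y, Z` in the spanning rows
  obtain ⟨Xh, hX⟩ := exists_matrix_mul_eq_of_span_rows_eq_top A hA X
  obtain ⟨Yh, hY⟩ := exists_matrix_mul_eq_of_span_rows_eq_top B hB Y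
  obtain ⟨Zh, hZ⟩ := exists_matrix_mul_eq_of_span_rows_eq_top C hC Z
  -- echelon forms of the coefficient matrices
  obtain ⟨r₁, s₁, U, π₁, hU, hπ₁, hU₁, hU₂⟩ := exists_echelon_rows Xh
  obtain ⟨r₂, s₂, V, π₂, hV, hπ₂, hV₁, hV₂⟩ := exists_echelon_rows Yh
  obtain ⟨r₃, s₃, W, π₃, hW, hπ₃, hW₁, hW₂⟩ := exists_echelon_rows Zh
  refine ⟨r₁ + s₁, r₂ + s₂, r₃ + s₃, U, V, W, hU, hV, hW, ?_⟩
  have hg : actTensor U V W (actTensor X Y Z f) =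
      actTensor (U * Xh) (V * Yh) (W * Zh) (actTensor A B C f) := by
    rw [hX, hY, hZ, ← actTensor_actTensor Xh Yh Zh A B C f, actTensor_actTensor]
  rw [hg]
  set fh := actTensor A B C f with hfh
  set g' := actTensor (U * Xh) (V * Yh) (W * Zh) fh with hg'
  -- every support point of `g'` lies in nonzero rows and dominates, via the pivots, a point of `supp fh`
  have key : ∀ a' b' c', g' a' b' c' ≠ 0 → ∃ (h₁ : a'.val < r₁) (h₂ : b'.val < r₂) (h₃ : c'.val < r₃),
      ∃ y ∈ tensorSupport fh, (π₁ (a'.castLT h₁), π₂ (b'.castLT h₂), π₃ (c'.castLT h₃)) ≤ y := by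
    intro a' b' c' hne
    obtain ⟨a, b, c, ha, hb, hc, hf⟩ := exists_of_actTensor_ne_zero _ _ _ _ hne
    have h₁ : a'.val < r₁ := by
      by_contra hlt
      have hle : r₁ ≤ a'.val := not_lt.1 hlt
      have h := hU₂ (Fin.subNat r₁ (a'.cast (Nat.add_comm _ _)) hle) a
      rw [Fin.natAdd_subNat_cast hle] at h
      exact ha h
    have h₂ : b'.val < r₂ := by
      by_contra hlt
      have hle : r₂ ≤ b'.val := not_lt.1 hlt
      have h := hV₂ (Fin.subNat r₂ (b'.cast (Nat.add_comm _ _)) hle) b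
      rw [Fin.natAdd_subNat_cast hle] at h
      exact hb h
    have h₃ : c'.val < r₃ := by
      by_contra hlt
      have hle : r₃ ≤ c'.val := not_lt.1 hlt
      have h := hW₂ (Fin.subNat r₃ (c'.cast (Nat.add_comm _ _)) hle) c
      rw [Fin.natAdd_subNat_cast hle] at h
      exact hc h
    have hπa : π₁ (a'.castLT h₁) ≤ a := by
      by_contra hlt
      have h := hU₁ (a'.castLT h₁) a (not_le.1 hlt)
      rw [Fin.castAdd_castLT] at h
      exact ha h
    have hπb : π₂ (b'.castLT h₂) ≤ b := by
      by_contra hlt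
      have h := hV₁ (b'.castLT h₂) b (not_le.1 hlt)
      rw [Fin.castAdd_castLT] at h
      exact hb h
    have hπc : π₃ (c'.castLT h₃) ≤ c := by
      by_contra hlt
      have h := hW₁ (c'.castLT h₃) c (not_le.1 hlt)
      rw [Fin.castAdd_castLT] at h
      exact hc h
    exact ⟨h₁, h₂, h₃, (a, b, c), hf, ⟨hπa, hπb, hπc⟩⟩
  -- the empty case
  by_cases hne : ∃ a' b' c', g' a' b' c' ≠ 0
  swap
  · have hempty : {x : Fin (r₁ + s₁) × Fin (r₂ + s₂) × Fin (r₃ + s₃) |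
        ∃ y ∈ tensorSupport g', x ≤ y} = ∅ := by
      ext x
      simp only [Set.mem_setOf_eq, Set.mem_empty_iff_false, iff_false]
      rintro ⟨y, hy, -⟩
      exact hne ⟨_, _, _, hy⟩
    rw [hempty, maxWeightedEntropy_empty]
    exact maxWeightedEntropy_nonneg hθ _
  obtain ⟨a₀, b₀, c₀, h₀⟩ := hne
  obtain ⟨-, -, -, y₀, -, -⟩ := key _ _ _ h₀
  -- the pivot maps, extended by a default value on the zero rows
  let ψ₁ : Fin (r₁ + s₁) → Fin N₁ := fun i => if h : i.val < r₁ then π₁ (i.castLT h) else y₀.1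
  let ψ₂ : Fin (r₂ + s₂) → Fin N₂ := fun i => if h : i.val < r₂ then π₂ (i.castLT h) else y₀.2.1
  let ψ₃ : Fin (r₃ + s₃) → Fin N₃ := fun i => if h : i.val < r₃ then π₃ (i.castLT h) else y₀.2.2
  have hψ₁ : ∀ i (h : i.val < r₁), ψ₁ i = π₁ (i.castLT h) := fun i h => dif_pos h
  have hψ₂ : ∀ i (h : i.val < r₂), ψ₂ i = π₂ (i.castLT h) := fun i h => dif_pos h
  have hψ₃ : ∀ i (h : i.val < r₃), ψ₃ i = π₃ (i.castLT h) := fun i h => dif_pos h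
  -- points of the down-closure lie in the nonzero rows
  have hlt : ∀ x : Fin (r₁ + s₁) × Fin (r₂ + s₂) × Fin (r₃ + s₃),
      x ∈ {x | ∃ y ∈ tensorSupport g', x ≤ y} →
        x.1.val < r₁ ∧ x.2.1.val < r₂ ∧ x.2.2.val < r₃ := by
    rintro x ⟨y, hy, hxy⟩
    obtain ⟨h₁, h₂, h₃, -⟩ := key _ _ _ hy
    exact ⟨lt_of_le_of_lt (Fin.le_def.1 hxy.1) h₁, lt_of_le_of_lt (Fin.le_def.1 hxy.2.1) h₂,
      lt_of_le_of_lt (Fin.le_def.1 hxy.2.2) h₃⟩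
  have castLT_inj : ∀ {n m : ℕ} (i j : Fin n) (hi : i.val < m) (hj : j.val < m),
      i.castLT hi = j.castLT hj → i = j := fun i j hi hj h => Fin.ext (by simpa [Fin.ext_iff] using h)
  have castLT_mono : ∀ {n m : ℕ} (i j : Fin n) (hi : i.val < m) (hj : j.val < m),
      i ≤ j → i.castLT hi ≤ j.castLT hj := fun i j hi hj h => Fin.le_def.2 (Fin.le_def.1 h)
  refine maxWeightedEntropy_le_of_injOn hθ ψ₁ ψ₂ ψ₃ ?_ ?_ ?_ ?_
  · rintro _ ⟨x, hx, rfl⟩ _ ⟨x', hx', rfl⟩ h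
    have h1 := (hlt x hx).1
    have h1' := (hlt x' hx').1
    rw [hψ₁ _ h1, hψ₁ _ h1'] at h
    exact castLT_inj _ _ h1 h1' (hπ₁.injective h)
  · rintro _ ⟨x, hx, rfl⟩ _ ⟨x', hx', rfl⟩ h
    have h2 := (hlt x hx).2.1
    have h2' := (hlt x' hx').2.1
    simp only at h
    rw [hψ₂ _ h2, hψ₂ _ h2'] at h
    exact castLT_inj _ _ h2 h2' (hπ₂.injective h)
  · rintro _ ⟨x, hx, rfl⟩ _ ⟨x', hx', rfl⟩ h
    have h3 := (hlt x hx).2.2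
    have h3' := (hlt x' hx').2.2
    simp only at h
    rw [hψ₃ _ h3, hψ₃ _ h3'] at h
    exact castLT_inj _ _ h3 h3' (hπ₃.injective h)
  · rintro x ⟨y, hy, hxy⟩
    obtain ⟨hy₁, hy₂, hy₃, z, hz, hyz⟩ := key _ _ _ hy
    obtain ⟨hx₁, hx₂, hx₃⟩ := hlt x ⟨y, hy, hxy⟩
    refine ⟨z, hz, ?_⟩
    rw [hψ₁ _ hx₁, hψ₂ _ hx₂, hψ₃ _ hx₃]
    refine le_trans ?_ hyz
    exact ⟨hπ₁.monotone (castLT_mono _ _ hx₁ hy₁ hxy.1),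
      hπ₂.monotone (castLT_mono _ _ hx₂ hy₂ hxy.2.1),
      hπ₃.monotone (castLT_mono _ _ hx₃ hy₃ hxy.2.2)⟩

end Monotone

/-! ## The product bound from a dual certificate -/

section Product

variable {K : Type*} [Field K] {ι κ μ : Type*} [Fintype ι] [Fintype κ] [Fintype μ]
  [DecidableEq ι] [DecidableEq κ] [DecidableEq μ]

/-- The sum of a product certificate over all sequences: `∑_x ∏ⱼ Q(xⱼ) = (∑ Q)^k`. [folklore] -/
theorem sum_prod_apply_eq_pow {α : Type*} [Fintype α] [DecidableEq α] (Q : α → ℝ) (k : ℕ) :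
    (∑ x : Fin k → α, ∏ j, Q (x j)) = (∑ a, Q a) ^ k := by
  rw [Finset.sum_pow']
  refine Finset.sum_congr ?_ fun _ _ => rfl
  exact (Fintype.piFinset_univ).symm

/-- **The product bound for the flag support entropy from a dual certificate** (the evaluation of
Strassen's upper support functional on powers, CVZ Thm. 2.4 (3)/(5); CLLZ §4.4, eq. (9)): let
`θ ≥ 0` and let `Q₁, Q₂, Q₃` be positive sub-probability vectors whose cost
`θ₀ log₂(1/Q₁(a)) + θ₁ log₂(1/Q₂(b)) + θ₂ log₂(1/Q₃(c))` is `≤ V` on `supp t` (`V ≥ 0`). Then `t^{⊗k}`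
has a frame — the standard bases of the three sequence spaces, sorted by cost — whose down-closed
support has `θ`-entropy `≤ k V` (weak duality with the product certificate `Q^{⊗k}`, whose cost is
additive over the `k` coordinates and monotone in the sorted orders).
[cite: ChristandlLeGallLysikovZuiddam2025, §4.4 (eq. (9))] -/
theorem exists_frame_kroneckerPow_le (t : ι → κ → μ → K) (k : ℕ) {θ : Fin 3 → ℝ}
    (hθ : ∀ i, 0 ≤ θ i) {Q₁ : ι → ℝ} {Q₂ : κ → ℝ} {Q₃ : μ → ℝ} (hQ₁ : ∀ a, 0 < Q₁ a)
    (hQ₁' : ∑ a, Q₁ a ≤ 1) (hQ₂ : ∀ b, 0 < Q₂ b) (hQ₂' : ∑ b, Q₂ b ≤ 1) (hQ₃ : ∀ c, 0 < Q₃ c)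
    (hQ₃' : ∑ c, Q₃ c ≤ 1) {V : ℝ} (hV0 : 0 ≤ V)
    (hV : ∀ a b c, t a b c ≠ 0 → θ 0 * (-Real.log (Q₁ a) / Real.log 2) +
      θ 1 * (-Real.log (Q₂ b) / Real.log 2) + θ 2 * (-Real.log (Q₃ c) / Real.log 2) ≤ V) :
    ∃ (A : Matrix (Fin (Fintype.card (Fin k → ι))) (Fin k → ι) K)
      (B : Matrix (Fin (Fintype.card (Fin k → κ))) (Fin k → κ) K)
      (C : Matrix (Fin (Fintype.card (Fin k → μ))) (Fin k → μ) K),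
      Submodule.span K (Set.range A.row) = ⊤ ∧ Submodule.span K (Set.range B.row) = ⊤ ∧
      Submodule.span K (Set.range C.row) = ⊤ ∧
      maxWeightedEntropy θ {x | ∃ y ∈ tensorSupport (actTensor A B C (kroneckerPow t k)), x ≤ y} ≤
        k * V := by
  -- costs of sequences
  let c₁ : (Fin k → ι) → ℝ := fun x => ∑ j, -Real.log (Q₁ (x j)) / Real.log 2
  let c₂ : (Fin k → κ) → ℝ := fun x => ∑ j, -Real.log (Q₂ (x j)) / Real.log 2
  let c₃ : (Fin k → μ) → ℝ := fun x => ∑ j, -Real.log (Q₃ (x j)) / Real.log 2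
  -- cost-sorted enumerations of the three sequence spaces
  let e₁ := (Fintype.equivFin (Fin k → ι)).symm
  let e₂ := (Fintype.equivFin (Fin k → κ)).symm
  let e₃ := (Fintype.equivFin (Fin k → μ)).symm
  let ρ₁ : Fin (Fintype.card (Fin k → ι)) → (Fin k → ι) := fun i => e₁ (Tuple.sort (c₁ ∘ e₁) i)
  let ρ₂ : Fin (Fintype.card (Fin k → κ)) → (Fin k → κ) := fun i => e₂ (Tuple.sort (c₂ ∘ e₂) i)
  let ρ₃ : Fin (Fintype.card (Fin k → μ)) → (Fin k → μ) := fun i => e₃ (Tuple.sort (c₃ ∘ e₃) i)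
  have hm₁ : Monotone (c₁ ∘ ρ₁) := Tuple.monotone_sort (c₁ ∘ e₁)
  have hm₂ : Monotone (c₂ ∘ ρ₂) := Tuple.monotone_sort (c₂ ∘ e₂)
  have hm₃ : Monotone (c₃ ∘ ρ₃) := Tuple.monotone_sort (c₃ ∘ e₃)
  have hb₁ : Function.Bijective ρ₁ := e₁.bijective.comp (Tuple.sort (c₁ ∘ e₁)).bijective
  have hb₂ : Function.Bijective ρ₂ := e₂.bijective.comp (Tuple.sort (c₂ ∘ e₂)).bijective
  have hb₃ : Function.Bijective ρ₃ := e₃.bijective.comp (Tuple.sort (c₃ ∘ e₃)).bijective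
  refine ⟨Matrix.of fun a' a => if a = ρ₁ a' then (1 : K) else 0,
    Matrix.of fun b' b => if b = ρ₂ b' then (1 : K) else 0,
    Matrix.of fun c' c => if c = ρ₃ c' then (1 : K) else 0,
    span_rows_reindex_eq_top hb₁.surjective, span_rows_reindex_eq_top hb₂.surjective,
    span_rows_reindex_eq_top hb₃.surjective, ?_⟩
  rw [actTensor_reindex]
  -- the transported product certificate has additive cost
  have hlog₁ : ∀ x : Fin k → ι,
      -Real.log (∏ j, Q₁ (x j)) / Real.log 2 = ∑ j, -Real.log (Q₁ (x j)) / Real.log 2 := by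
    intro x
    rw [Real.log_prod fun j _ => (hQ₁ _).ne', ← Finset.sum_neg_distrib, Finset.sum_div]
  have hlog₂ : ∀ x : Fin k → κ,
      -Real.log (∏ j, Q₂ (x j)) / Real.log 2 = ∑ j, -Real.log (Q₂ (x j)) / Real.log 2 := by
    intro x
    rw [Real.log_prod fun j _ => (hQ₂ _).ne', ← Finset.sum_neg_distrib, Finset.sum_div]
  have hlog₃ : ∀ x : Fin k → μ,
      -Real.log (∏ j, Q₃ (x j)) / Real.log 2 = ∑ j, -Real.log (Q₃ (x j)) / Real.log 2 := by
    intro x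
    rw [Real.log_prod fun j _ => (hQ₃ _).ne', ← Finset.sum_neg_distrib, Finset.sum_div]
  refine maxWeightedEntropy_le_of_cost_le hθ (Q₁ := fun a' => ∏ j, Q₁ (ρ₁ a' j))
    (Q₂ := fun b' => ∏ j, Q₂ (ρ₂ b' j)) (Q₃ := fun c' => ∏ j, Q₃ (ρ₃ c' j))
    (fun a' => Finset.prod_pos fun j _ => hQ₁ _) ?_ (fun b' => Finset.prod_pos fun j _ => hQ₂ _) ?_
    (fun c' => Finset.prod_pos fun j _ => hQ₃ _) ?_ (by positivity) ?_
  · rw [hb₁.sum_comp (g := fun x : Fin k → ι => ∏ j, Q₁ (x j)), sum_prod_apply_eq_pow]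
    exact pow_le_one₀ (Finset.sum_nonneg fun a _ => (hQ₁ a).le) hQ₁'
  · rw [hb₂.sum_comp (g := fun x : Fin k → κ => ∏ j, Q₂ (x j)), sum_prod_apply_eq_pow]
    exact pow_le_one₀ (Finset.sum_nonneg fun b _ => (hQ₂ b).le) hQ₂'
  · rw [hb₃.sum_comp (g := fun x : Fin k → μ => ∏ j, Q₃ (x j)), sum_prod_apply_eq_pow]
    exact pow_le_one₀ (Finset.sum_nonneg fun c _ => (hQ₃ c).le) hQ₃'
  · rintro x ⟨y, hy, hxy⟩
    rw [hlog₁, hlog₂, hlog₃]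
    change θ 0 * c₁ (ρ₁ x.1) + θ 1 * c₂ (ρ₂ x.2.1) + θ 2 * c₃ (ρ₃ x.2.2) ≤ k * V
    -- the support point `y` has all `k` coordinate triples in `supp t`
    have hy' : ∀ j, t (ρ₁ y.1 j) (ρ₂ y.2.1 j) (ρ₃ y.2.2 j) ≠ 0 := by
      have h : kroneckerPow t k (ρ₁ y.1) (ρ₂ y.2.1) (ρ₃ y.2.2) ≠ 0 := hy
      rw [kroneckerPow_apply] at h
      exact fun j => (Finset.prod_ne_zero_iff.1 h) j (Finset.mem_univ j)
    calc θ 0 * c₁ (ρ₁ x.1) + θ 1 * c₂ (ρ₂ x.2.1) + θ 2 * c₃ (ρ₃ x.2.2)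
        ≤ θ 0 * c₁ (ρ₁ y.1) + θ 1 * c₂ (ρ₂ y.2.1) + θ 2 * c₃ (ρ₃ y.2.2) :=
          add_le_add (add_le_add (mul_le_mul_of_nonneg_left (hm₁ hxy.1) (hθ 0))
            (mul_le_mul_of_nonneg_left (hm₂ hxy.2.1) (hθ 1)))
            (mul_le_mul_of_nonneg_left (hm₃ hxy.2.2) (hθ 2))
      _ = ∑ j, (θ 0 * (-Real.log (Q₁ (ρ₁ y.1 j)) / Real.log 2) +
            θ 1 * (-Real.log (Q₂ (ρ₂ y.2.1 j)) / Real.log 2) +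
            θ 2 * (-Real.log (Q₃ (ρ₃ y.2.2 j)) / Real.log 2)) := by
          simp only [c₁, c₂, c₃, Finset.mul_sum, Finset.sum_add_distrib]
      _ ≤ ∑ _j : Fin k, V := Finset.sum_le_sum fun j _ => hV _ _ _ (hy' j)
      _ = k * V := by simp

end Product

end Literature.Computability.AlgebraicComplexity

end
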